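import Mathlib.Analysis.SpecificLimits.Normed
import Mathlib.Analysis.Normed.Group.InfiniteSum
import Literature.Barriers.CriticalPhenomena.WeaklySAWCriticalNuRGReduction
import HarnessLib

/-!
# BBS 2015, §8.5 proved: `μ₀ᶜ(0,g₀) = -2C(0)g₀ + O(g₀²)` from the flow of `μ̌_j`, and the named
# fact `CTWSAW.BBS2015_thm41_nu0c` reduced to Theorem 4.1's data with Proposition 7.1's flow

Companion to `WeaklySAWCriticalNuRGReduction.lean`, whose named fact `CTWSAW.BBS2015_thm41_nu0c`
(Bauerschmidt–Brydges–Slade, CMP 337 (2015), arXiv:1403.7422) bundles **Theorem 4.1** (the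
predicate `CTWSAW.Thm41Data`) with the conclusion of **§8.5** for the same critical initial
condition, `ν₀ᶜ(0,g₀) = μ₀ᶜ(0,g₀) = -2C(0)g₀ + O(g₀²)` (`C(0) = C₀(0) = greenZero 4`); Theorem 1.2
is proved from that fact and Lemma A.1 there.

## Triage of a discharge of `BBS2015_thm41_nu0c` (XL), and the one elementary page

Theorem 4.1 is proved in §8.4 for `(ν₀ᶜ, z₀ᶜ) = (μ₀ᶜ, z₀ᶜ)` of **Proposition 7.1** ("Functions
`z₀ᶜ` and `ν₀ᶜ = μ₀ᶜ` with the regularity properties required by Theorem 4.1 were constructed in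
Proposition 7.1", opening of §8), i.e. for the initial condition of the global renormalisation-
group flow `(V_j, K_j)` in Banach spaces of polymer activities (§5–7; Proposition 3.1, the
supersymmetric representation; the companion papers [BS-rg-norm], [BS-rg-loc], [BBS-rg-pt],
[BS-rg-IE], [BS-rg-step], [BBS-rg-flow]) — a theory, none of it in the tree. The one elementary
page is §8.5: "By Proposition 7.1, `μ₀ᶜ = μ̌₀` where the sequence `μ̌_j` satisfies
`μ̌_{j+1} = L²μ̌_j(1 - γβ_jǧ_j) + η_jǧ_j + O(χ_jḡ_j²)` … We also recall from [BBS-rg-pt] that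
`η_j = 2L^{2(j+1)}C_{j+1;0,0}`. By Proposition 7.1, the sequence `μ̌_j` is bounded, so infinite
iteration gives `μ̌₀ = -Σ_{l≥0}(L^{-2(l+1)}Π_{k≤l}(1 - γβ_kǧ_k)⁻¹)(η_lǧ_l + O(χ_lḡ_l²))` … Since
`C(0) = Σ_{l≥0} C_{l+1;0,0}` … `μ̌₀ = -2C(0)g₀ + O(g₀²)`, and the proof is complete."

## What this file does

* PROVED, `CTWSAW.abs_mu_zero_add_le` — that page as an explicit inequality of real analysis: for
  `L > 1`, `Σ_j C₁ j = G`, `|C₁ j|L^{2j} ≤ A`, `|β_j| ≤ B`, `0 < g₀ ≤ muFlowThreshold L A B`, and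
  sequences with `ǧ₀ = g₀`, `μ̌` bounded, `|ǧ_j| ≤ Ag₀`, the `μ̌`-recursion (`γ = ¼`,
  `η_j = 2L^{2(j+1)}C₁ j`, error `≤ Ag₀²`) and the `ǧ`-recursion `ǧ_{j+1} = ǧ_j - β_jǧ_j² + r_j`,
  `|r_j| ≤ A|ǧ_j|³`: `|μ̌₀ + 2Gg₀| ≤ muFlowConst L A B · g₀²` (explicit constant). The infinite
  iteration is run on `d_j = μ̌_j - m_j`, `m_j = -2g₀L^{2j}Σ_{k≥j}C₁ k` the solution of the
  unperturbed recursion, via the discounted backward iteration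
  `|d₀| ≤ θⁿ|d_n| + Σ_{j<n}θ^{j+1}|f_j|`, `θ = 2/(L²+1)` (`abs_le_pow_mul_abs_add_sum`,
  `abs_le_of_iterate_bounded`, `sum_range_cast_succ_mul_pow_le`; folklore).
* `CTWSAW.MuFlowAt φ G δ' L A B C₁ β` — the inputs of §8.5 at `m² = 0` as a HYPOTHESIS structure
  (like `Thm41Data`; nothing asserted): Proposition 7.1's flow for every `g₀ ∈ (0,δ')` with
  `μ̌₀ = φ(g₀)`, the [BBS-rg-pt] coefficient `η_j`, `Σ C_{l+1;0,0} = G`, `C_{l+1;0,0} = O(L^{-2l})`,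
  `β_j` bounded. PROVED: `MuFlowAt.asymptotics` (`φ(g₀) = -2Gg₀ + O(g₀²)`), and conversely
  `MuFlowAt.of_bound` (the asymptotics alone furnish such data) — so, at this abstraction, a
  named fact "Theorem 4.1 ∧ flow inputs" would merely restate `BBS2015_thm41_nu0c` and is NOT
  vendored; the renormalisation-group input stays `BBS2015_thm41_nu0c`.
* PROVED, `CTWSAW.BBS2015_thm41_nu0c_of_muFlowAt` — `BBS2015_thm41_nu0c` from `Thm41Data …` and
  `MuFlowAt (ν₀c 0) (greenZero 4) …`; with the sibling files, Theorem 1.2 from Theorem 4.1's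
  data, the flow inputs and Lemma A.1 (`BBS2015_thm12_of_muFlowAt_of_lemA1`): the printed "Proof
  of Theorem 1.2" is checked down to Theorem 4.1 and Proposition 7.1's flow.

Locators: Theorem 4.1, Propositions 6.1, 7.1, Assumption (A1) (§6.1) and §8.5 by number/name
(arXiv = CMP numbering); the displays of §8.3/§8.5 by content (display numbers are not legible
in the held text).
-/

noncomputable section

open Set Filter Topology Finset

namespace Literature.Barriers.CriticalPhenomena

namespace CTWSAW

/-! ### Elementary lemmas: discounted backward iteration of a linear recursion -/

/-- Discounted backward iteration: if `x_{j+1} = Λ a_j x_j + f_j` with `θΛa_j ≥ 1`, `θ ≥ 0`, then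
`|x_k| ≤ θⁿ|x_{k+n}| + Σ_{j<n} θ^{j+1}|f_{k+j}|` (the finite form of the "infinite iteration" of
§8.5 of Bauerschmidt–Brydges–Slade 2015). [folklore] -/
theorem abs_le_pow_mul_abs_add_sum {Λ θ : ℝ} {a f x : ℕ → ℝ} (hθ : 0 ≤ θ)
    (ha : ∀ j, 1 ≤ θ * (Λ * a j)) (hrec : ∀ j, x (j + 1) = Λ * a j * x j + f j) (k n : ℕ) :
    |x k| ≤ θ ^ n * |x (k + n)| + ∑ j ∈ range n, θ ^ (j + 1) * |f (k + j)| := by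
  induction n generalizing k with
  | zero => simp
  | succ n ih =>
    have hstep : ∀ i, |x i| ≤ θ * |x (i + 1)| + θ * |f i| := fun i => by
      have hpos : 0 < Λ * a i := by
        rcases le_or_gt (Λ * a i) 0 with hle | hlt
        · have h0 := mul_nonpos_of_nonneg_of_nonpos hθ hle
          linarith [ha i]
        · exact hlt
      calc |x i| ≤ θ * (Λ * a i) * |x i| := le_mul_of_one_le_left (abs_nonneg _) (ha i)
        _ = θ * |x (i + 1) - f i| := by
            rw [hrec i, add_sub_cancel_right, abs_mul, abs_of_pos hpos]
            ring
        _ ≤ θ * (|x (i + 1)| + |f i|) := by gcongr; exact abs_sub _ _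
        _ = θ * |x (i + 1)| + θ * |f i| := by ring
    calc |x k| ≤ θ * |x (k + 1)| + θ * |f k| := hstep k
      _ ≤ θ * (θ ^ n * |x (k + 1 + n)| + ∑ j ∈ range n, θ ^ (j + 1) * |f (k + 1 + j)|) +
            θ * |f k| := by gcongr; exact ih (k + 1)
      _ = θ ^ (n + 1) * |x (k + (n + 1))| + ∑ j ∈ range (n + 1), θ ^ (j + 1) * |f (k + j)| := by
          have e1 : k + 1 + n = k + (n + 1) := by omega
          have e2 : ∑ j ∈ range (n + 1), θ ^ (j + 1) * |f (k + j)| =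
              ∑ j ∈ range n, θ ^ (j + 1 + 1) * |f (k + 1 + j)| + θ * |f k| := by
            rw [sum_range_succ']
            congr 1
            · exact sum_congr rfl fun j _ => by rw [show k + (j + 1) = k + 1 + j by omega]
            · simp
          have e3 : θ * ∑ j ∈ range n, θ ^ (j + 1) * |f (k + 1 + j)| =
              ∑ j ∈ range n, θ ^ (j + 1 + 1) * |f (k + 1 + j)| := by
            rw [mul_sum]
            exact sum_congr rfl fun j _ => by ring
          rw [e1, e2, mul_add, e3]
          ring

/-- Infinite iteration for a BOUNDED solution: under the hypotheses of
`abs_le_pow_mul_abs_add_sum` with `θ < 1`, `|x_j| ≤ M` and `Σ_{j<n} θ^{j+1}|f_j| ≤ S` for all `n`,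
`|x₀| ≤ S` ("the sequence `μ̌_j` is bounded, so infinite iteration gives …", §8.5). [folklore] -/
theorem abs_le_of_iterate_bounded {Λ θ M S : ℝ} {a f x : ℕ → ℝ} (hθ : 0 ≤ θ) (hθ1 : θ < 1)
    (ha : ∀ j, 1 ≤ θ * (Λ * a j)) (hrec : ∀ j, x (j + 1) = Λ * a j * x j + f j)
    (hM : ∀ j, |x j| ≤ M) (hS : ∀ n, ∑ j ∈ range n, θ ^ (j + 1) * |f j| ≤ S) : |x 0| ≤ S := by
  have key : ∀ n : ℕ, |x 0| ≤ θ ^ n * M + S := fun n => by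
    have h := abs_le_pow_mul_abs_add_sum hθ ha hrec 0 n
    simp only [zero_add] at h
    exact h.trans (add_le_add (mul_le_mul_of_nonneg_left (hM n) (pow_nonneg hθ n)) (hS n))
  have hlim : Tendsto (fun n : ℕ => θ ^ n * M + S) atTop (𝓝 (0 * M + S)) :=
    ((tendsto_pow_atTop_nhds_zero_of_lt_one hθ hθ1).mul_const M).add_const S
  rw [zero_mul, zero_add] at hlim
  exact ge_of_tendsto' hlim key

/-- `Σ_{j<n} (j+1)θ^{j+1} ≤ θ/(1-θ)²` for `0 ≤ θ < 1` (partial sums of `Σ_n nθⁿ = θ/(1-θ)²`).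
[folklore] -/
theorem sum_range_cast_succ_mul_pow_le {θ : ℝ} (hθ : 0 ≤ θ) (hθ1 : θ < 1) (n : ℕ) :
    ∑ j ∈ range n, ((j : ℝ) + 1) * θ ^ (j + 1) ≤ θ / (1 - θ) ^ 2 := by
  have h := hasSum_coe_mul_geometric_of_norm_lt_one (𝕜 := ℝ) (r := θ)
    (by rwa [Real.norm_eq_abs, abs_of_nonneg hθ])
  have h2 : ∑ i ∈ range (n + 1), (i : ℝ) * θ ^ i ≤ θ / (1 - θ) ^ 2 :=
    sum_le_hasSum (range (n + 1)) (fun i _ => by positivity) h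
  calc ∑ j ∈ range n, ((j : ℝ) + 1) * θ ^ (j + 1) = ∑ i ∈ range (n + 1), (i : ℝ) * θ ^ i := by
        rw [sum_range_succ']
        push_cast
        simp
    _ ≤ θ / (1 - θ) ^ 2 := h2

/-! ### §8.5 proved: `μ̌₀ = -2C(0)g₀ + O(g₀²)`, with explicit constant and threshold -/

/-- The smallness threshold on `g₀` in the §8.5 estimate: `g₀ ≤ 1` and `¼BAg₀ ≤ ε₀ = (1 - L⁻²)/2`
(so that `1 - ¼β_jǧ_j ≥ 1 - ε₀` and `L²(1 - ε₀) = (L²+1)/2 > 1`). [folklore] -/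
def muFlowThreshold (L A B : ℝ) : ℝ :=
  min 1 ((1 - (L ^ 2)⁻¹) / 2 / (B * A / 4 + 1))

/-- The explicit `O(g₀²)` constant of the §8.5 estimate, `(c₁ + c₂)θ/(1-θ)²` with `θ = 2/(L²+1)`,
`c₁ = 2L²(¼BA)(A(1 - L⁻²)⁻¹) + A`, `c₂ = 2L²A(BA² + A⁴)`. [folklore] -/
def muFlowConst (L A B : ℝ) : ℝ :=
  (2 * L ^ 2 * (B * A / 4) * (A * (1 - (L ^ 2)⁻¹)⁻¹) + A + 2 * L ^ 2 * A * (B * A ^ 2 + A ^ 4)) *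
    (2 / (L ^ 2 + 1) / (1 - 2 / (L ^ 2 + 1)) ^ 2)

/-- The threshold is positive for `L > 1`, `A, B ≥ 0`. [folklore] -/
theorem muFlowThreshold_pos {L A B : ℝ} (hL : 1 < L) (hA : 0 ≤ A) (hB : 0 ≤ B) :
    0 < muFlowThreshold L A B := by
  have hΛ1 : 1 < L ^ 2 := by nlinarith
  have hΛinv1 : (L ^ 2)⁻¹ < 1 := inv_lt_one_of_one_lt₀ hΛ1
  unfold muFlowThreshold
  refine lt_min one_pos (div_pos (by linarith) (by positivity))

/-- **§8.5 of Bauerschmidt–Brydges–Slade 2015 as an explicit inequality** (one `g₀`, one flow).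
Data: `L > 1`; `C₁ j = C_{j+1;0,0}` with `Σ_j C₁ j = G` (`= C(0)`) and `|C₁ j|L^{2j} ≤ A`
(`C_{l+1;0,0} = O(L^{-2l})`); `|β_j| ≤ B`; `0 < g₀ ≤ muFlowThreshold L A B`; sequences with
`ǧ₀ = g₀`, `|μ̌_j| ≤ M` (bounded), `|ǧ_j| ≤ Ag₀`, the `μ̌`-recursion
`μ̌_{j+1} = L²μ̌_j(1 - ¼β_jǧ_j) + 2L^{2(j+1)}C₁ jǧ_j + e_j`, `|e_j| ≤ Ag₀²`, and the `ǧ`-recursion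
`ǧ_{j+1} = ǧ_j - β_jǧ_j² + r_j`, `|r_j| ≤ A|ǧ_j|³`. Conclusion:
`|μ̌₀ + 2Gg₀| ≤ muFlowConst L A B · g₀²`. Proof: with `Λ = L²`, `a_j = 1 - ¼β_jǧ_j`,
`T_j = Σ_{k≥j} C₁ k` (`|Λ^jT_j| ≤ A(1-Λ⁻¹)⁻¹ =: A'`), the comparison sequence `m_j = -2g₀Λ^jT_j`
solves the unperturbed recursion `m_{j+1} = Λm_j + 2Λ^{j+1}C₁ j g₀`, so `d_j = μ̌_j - m_j` is
bounded and obeys `d_{j+1} = Λa_jd_j + f_j`, `f_j = Λ(a_j-1)m_j + 2Λ^{j+1}C₁ j(ǧ_j - g₀) + e_j`,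
`|f_j| ≤ (c₁ + c₂j)g₀²` (using `|ǧ_j - g₀| ≤ j(BA²+A⁴)g₀²`); since `¼BAg₀ ≤ ε₀ = (1-Λ⁻¹)/2`,
`θΛa_j ≥ 1` for `θ = 2/(Λ+1) < 1`, and `abs_le_of_iterate_bounded` with
`Σ_{j<n}(j+1)θ^{j+1} ≤ θ/(1-θ)²` gives `|d₀| = |μ̌₀ + 2Gg₀| ≤ (c₁+c₂)θ(1-θ)⁻²g₀²`. (The printed
route instead evaluates the products `Π(1 - γβ_kǧ_k)⁻¹ = (ǧ₀/ǧ_{l+1})^γ(c₀ + O(χ_lḡ_l))` and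
the drift `ǧ_l^{1-γ} - g₀^{1-γ}`; the cruder bounds suffice for `O(g₀²)`.)
[cite: BauerschmidtBrydgesSlade2015LogCorr, §8.5 (proof of Theorem 1.2)] -/
theorem abs_mu_zero_add_le {L A B G g₀ M : ℝ} {μ gc e r C₁ β : ℕ → ℝ} (hL : 1 < L)
    (hsum : HasSum C₁ G) (hC₁L : ∀ j, |C₁ j| * L ^ (2 * j) ≤ A) (hβ : ∀ j, |β j| ≤ B)
    (hg₀ : 0 < g₀) (hg₀t : g₀ ≤ muFlowThreshold L A B) (hgc0 : gc 0 = g₀)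
    (hμM : ∀ j, |μ j| ≤ M) (hgcA : ∀ j, |gc j| ≤ A * g₀)
    (hrec : ∀ j, μ (j + 1) =
      L ^ 2 * μ j * (1 - (1 / 4 : ℝ) * β j * gc j) + 2 * L ^ (2 * (j + 1)) * C₁ j * gc j + e j)
    (he : ∀ j, |e j| ≤ A * g₀ ^ 2) (hgrec : ∀ j, gc (j + 1) = gc j - β j * gc j ^ 2 + r j)
    (hr : ∀ j, |r j| ≤ A * |gc j| ^ 3) :
    |μ 0 + 2 * G * g₀| ≤ muFlowConst L A B * g₀ ^ 2 := by
  have hA : 0 ≤ A := by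
    have h0 := hC₁L 0
    simp only [mul_zero, pow_zero, mul_one] at h0
    exact (abs_nonneg _).trans h0
  have hB : 0 ≤ B := (abs_nonneg _).trans (hβ 0)
  -- constants
  obtain ⟨Λ, hΛ⟩ : ∃ Λ : ℝ, Λ = L ^ 2 := ⟨_, rfl⟩
  have hΛ1 : 1 < Λ := by rw [hΛ]; nlinarith [hL]
  have hΛ0 : 0 < Λ := zero_lt_one.trans hΛ1
  have hΛinv1 : Λ⁻¹ < 1 := inv_lt_one_of_one_lt₀ hΛ1
  have hΛinv0 : 0 < Λ⁻¹ := inv_pos.2 hΛ0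
  obtain ⟨ε₀, hε₀⟩ : ∃ ε₀ : ℝ, ε₀ = (1 - Λ⁻¹) / 2 := ⟨_, rfl⟩
  have hε₀pos : 0 < ε₀ := by rw [hε₀]; linarith
  obtain ⟨θ, hθ⟩ : ∃ θ : ℝ, θ = 2 / (Λ + 1) := ⟨_, rfl⟩
  have hθ0 : 0 < θ := by rw [hθ]; positivity
  have hθ1 : θ < 1 := by rw [hθ, div_lt_one (by linarith)]; linarith
  have hθΛ : θ * (Λ * (1 - ε₀)) = 1 := by
    rw [hθ, hε₀]
    field_simp
    ring
  obtain ⟨κ, hκ⟩ : ∃ κ : ℝ, κ = B * A / 4 := ⟨_, rfl⟩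
  have hκ0 : 0 ≤ κ := by rw [hκ]; positivity
  obtain ⟨A', hA'⟩ : ∃ A' : ℝ, A' = A * (1 - Λ⁻¹)⁻¹ := ⟨_, rfl⟩
  have hA'0 : 0 ≤ A' := by rw [hA']; exact mul_nonneg hA (inv_nonneg.2 (by linarith))
  obtain ⟨D, hD⟩ : ∃ D : ℝ, D = B * A ^ 2 + A ^ 4 := ⟨_, rfl⟩
  have hD0 : 0 ≤ D := by rw [hD]; positivity
  obtain ⟨c₁, hc₁⟩ : ∃ c₁ : ℝ, c₁ = 2 * Λ * κ * A' + A := ⟨_, rfl⟩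
  have hc₁0 : 0 ≤ c₁ := by rw [hc₁]; positivity
  obtain ⟨c₂, hc₂⟩ : ∃ c₂ : ℝ, c₂ = 2 * Λ * A * D := ⟨_, rfl⟩
  have hc₂0 : 0 ≤ c₂ := by rw [hc₂]; positivity
  have hg₀1 : g₀ ≤ 1 := hg₀t.trans (min_le_left _ _)
  have hg₀ε : g₀ ≤ ε₀ / (κ + 1) := by
    have h2 : g₀ ≤ (1 - (L ^ 2)⁻¹) / 2 / (B * A / 4 + 1) := hg₀t.trans (min_le_right _ _)
    rwa [← hΛ, ← hε₀, ← hκ] at h2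
  have hκg : κ * g₀ ≤ ε₀ := by
    rw [le_div_iff₀ (by positivity)] at hg₀ε
    nlinarith
  -- `|C₁ j| Λ^j ≤ A`
  have hC₁ : ∀ j, Λ ^ j * |C₁ j| ≤ A := fun j => by
    have h1 := hC₁L j
    rw [pow_mul, ← hΛ] at h1
    linarith [mul_comm (|C₁ j|) (Λ ^ j)]
  -- the tails `T_j = Σ_{k≥j} C₁ k` and `|Λ^j T_j| ≤ A'`
  set T : ℕ → ℝ := fun j => G - ∑ k ∈ range j, C₁ k with hT
  have hT0 : T 0 = G := by simp [hT]
  have hTsucc : ∀ j, T (j + 1) = T j - C₁ j := fun j => by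
    simp only [hT, sum_range_succ]
    ring
  have hTbound : ∀ j, Λ ^ j * |T j| ≤ A' := by
    intro j
    have htail : HasSum (fun n => C₁ (n + j)) (T j) := (hasSum_nat_add_iff' j).2 hsum
    have hgeom : HasSum (fun n : ℕ => A * Λ⁻¹ ^ j * Λ⁻¹ ^ n) (A * Λ⁻¹ ^ j * (1 - Λ⁻¹)⁻¹) :=
      (hasSum_geometric_of_lt_one hΛinv0.le hΛinv1).mul_left _
    have hle : ∀ n, ‖C₁ (n + j)‖ ≤ A * Λ⁻¹ ^ j * Λ⁻¹ ^ n := fun n => by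
      rw [Real.norm_eq_abs]
      have hc := hC₁ (n + j)
      have hpos : 0 < Λ ^ (n + j) := pow_pos hΛ0 _
      rw [mul_comm, ← le_div_iff₀ hpos] at hc
      refine hc.trans (le_of_eq ?_)
      rw [inv_pow, inv_pow, pow_add]
      field_simp
    have hn := htail.norm_le_of_bounded hgeom hle
    rw [Real.norm_eq_abs] at hn
    calc Λ ^ j * |T j| ≤ Λ ^ j * (A * Λ⁻¹ ^ j * (1 - Λ⁻¹)⁻¹) := by gcongr
      _ = A' := by
          rw [hA', inv_pow]
          field_simp
  -- the comparison solution `m_j`, the difference `d_j`, the forcing `f_j`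
  set a : ℕ → ℝ := fun j => 1 - (1 / 4 : ℝ) * β j * gc j with ha_def
  set m : ℕ → ℝ := fun j => -2 * g₀ * Λ ^ j * T j with hm
  set d : ℕ → ℝ := fun j => μ j - m j with hd
  set f : ℕ → ℝ := fun j => Λ * (a j - 1) * m j + 2 * Λ ^ (j + 1) * C₁ j * (gc j - g₀) + e j
    with hf
  have hdrec : ∀ j, d (j + 1) = Λ * a j * d j + f j := by
    intro j
    have h1 := hrec j
    rw [pow_mul, ← hΛ] at h1
    simp only [hd, hm, hf, ha_def, hTsucc j, h1]
    ring
  -- `|a_j - 1| ≤ κ g₀ ≤ ε₀`, hence `θ Λ a_j ≥ 1`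
  have ha1 : ∀ j, |a j - 1| ≤ κ * g₀ := fun j => by
    simp only [ha_def]
    rw [show 1 - 1 / 4 * β j * gc j - 1 = -(1 / 4 * β j * gc j) by ring, abs_neg, abs_mul, abs_mul,
      abs_of_pos (by norm_num : (0 : ℝ) < 1 / 4), hκ]
    calc 1 / 4 * |β j| * |gc j| ≤ 1 / 4 * B * (A * g₀) := by
          gcongr
          · exact hβ j
          · exact hgcA j
      _ = B * A / 4 * g₀ := by ring
  have haθ : ∀ j, 1 ≤ θ * (Λ * a j) := fun j => by
    have h1 : 1 - ε₀ ≤ a j := by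
      have h2 := (abs_le.1 (ha1 j)).1
      linarith
    calc (1 : ℝ) = θ * (Λ * (1 - ε₀)) := hθΛ.symm
      _ ≤ θ * (Λ * a j) := by gcongr
  -- drift of `ǧ`: `|ǧ_j - g₀| ≤ j D g₀²`
  have hdrift1 : ∀ j, |gc (j + 1) - gc j| ≤ D * g₀ ^ 2 := fun j => by
    rw [hgrec j, show gc j - β j * gc j ^ 2 + r j - gc j = r j - β j * gc j ^ 2 by ring]
    have hgc := hgcA j
    have hsq : gc j ^ 2 ≤ (A * g₀) ^ 2 := by
      calc gc j ^ 2 = |gc j| ^ 2 := (sq_abs _).symm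
        _ ≤ (A * g₀) ^ 2 := by gcongr
    have hcube : |gc j| ^ 3 ≤ (A * g₀) ^ 3 := by gcongr
    calc |r j - β j * gc j ^ 2| ≤ |r j| + |β j * gc j ^ 2| := abs_sub _ _
      _ = |r j| + |β j| * gc j ^ 2 := by rw [abs_mul, abs_pow, sq_abs]
      _ ≤ A * (A * g₀) ^ 3 + B * (A * g₀) ^ 2 := by
          gcongr
          · exact (hr j).trans (by gcongr)
          · exact hβ j
      _ = A ^ 4 * g₀ ^ 2 * g₀ + B * A ^ 2 * g₀ ^ 2 := by ring
      _ ≤ A ^ 4 * g₀ ^ 2 * 1 + B * A ^ 2 * g₀ ^ 2 := by gcongr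
      _ = D * g₀ ^ 2 := by rw [hD]; ring
  have hdrift : ∀ j : ℕ, |gc j - g₀| ≤ (j : ℝ) * (D * g₀ ^ 2) := by
    intro j
    induction j with
    | zero => simp [hgc0]
    | succ j ih =>
      calc |gc (j + 1) - g₀| = |(gc (j + 1) - gc j) + (gc j - g₀)| := by ring_nf
        _ ≤ |gc (j + 1) - gc j| + |gc j - g₀| := abs_add_le _ _
        _ ≤ D * g₀ ^ 2 + (j : ℝ) * (D * g₀ ^ 2) := add_le_add (hdrift1 j) ih
        _ = ((j + 1 : ℕ) : ℝ) * (D * g₀ ^ 2) := by push_cast; ring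
  -- `|m_j| ≤ 2 g₀ A'`
  have hm_le : ∀ j, |m j| ≤ 2 * g₀ * A' := fun j => by
    simp only [hm]
    rw [abs_mul, abs_mul, abs_mul, abs_neg, abs_two, abs_of_pos hg₀,
      abs_of_pos (pow_pos hΛ0 j)]
    calc 2 * g₀ * Λ ^ j * |T j| = 2 * g₀ * (Λ ^ j * |T j|) := by ring
      _ ≤ 2 * g₀ * A' := by gcongr; exact hTbound j
  -- `|f_j| ≤ (c₁ + c₂)(j+1) g₀²`
  have hfb : ∀ j : ℕ, |f j| ≤ (c₁ + c₂) * ((j : ℝ) + 1) * g₀ ^ 2 := by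
    intro j
    have t1 : |Λ * (a j - 1) * m j| ≤ 2 * Λ * κ * A' * g₀ ^ 2 := by
      rw [abs_mul, abs_mul, abs_of_pos hΛ0]
      calc Λ * |a j - 1| * |m j| ≤ Λ * (κ * g₀) * (2 * g₀ * A') := by
            gcongr
            · exact ha1 j
            · exact hm_le j
        _ = 2 * Λ * κ * A' * g₀ ^ 2 := by ring
    have t2 : |2 * Λ ^ (j + 1) * C₁ j * (gc j - g₀)| ≤ 2 * Λ * A * ((j : ℝ) * (D * g₀ ^ 2)) := by
      rw [abs_mul, abs_mul, abs_mul, abs_two, abs_of_pos (pow_pos hΛ0 _), pow_succ]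
      calc 2 * (Λ ^ j * Λ) * |C₁ j| * |gc j - g₀| = 2 * Λ * (Λ ^ j * |C₁ j|) * |gc j - g₀| := by
            ring
        _ ≤ 2 * Λ * A * ((j : ℝ) * (D * g₀ ^ 2)) := by
            gcongr
            · exact hC₁ j
            · exact hdrift j
    have hj : (0 : ℝ) ≤ j := Nat.cast_nonneg j
    calc |f j| ≤ |Λ * (a j - 1) * m j + 2 * Λ ^ (j + 1) * C₁ j * (gc j - g₀)| + |e j| :=
          abs_add_le _ _
      _ ≤ |Λ * (a j - 1) * m j| + |2 * Λ ^ (j + 1) * C₁ j * (gc j - g₀)| + |e j| := by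
          gcongr
          exact abs_add_le _ _
      _ ≤ 2 * Λ * κ * A' * g₀ ^ 2 + 2 * Λ * A * ((j : ℝ) * (D * g₀ ^ 2)) + A * g₀ ^ 2 := by
          gcongr
          exact he j
      _ = (c₁ + c₂ * j) * g₀ ^ 2 := by rw [hc₁, hc₂]; ring
      _ ≤ (c₁ + c₂) * ((j : ℝ) + 1) * g₀ ^ 2 := by
          gcongr
          nlinarith
  -- `d` is bounded
  have hdM : ∀ j, |d j| ≤ M + 2 * g₀ * A' := fun j =>
    (abs_sub _ _).trans (add_le_add (hμM j) (hm_le j))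
  -- the discounted sums
  have hS : ∀ n, ∑ j ∈ range n, θ ^ (j + 1) * |f j| ≤ (c₁ + c₂) * (θ / (1 - θ) ^ 2) * g₀ ^ 2 :=
    fun n => by
    calc ∑ j ∈ range n, θ ^ (j + 1) * |f j|
        ≤ ∑ j ∈ range n, θ ^ (j + 1) * ((c₁ + c₂) * ((j : ℝ) + 1) * g₀ ^ 2) := by
          gcongr with j _
          exact hfb j
      _ = (c₁ + c₂) * g₀ ^ 2 * ∑ j ∈ range n, ((j : ℝ) + 1) * θ ^ (j + 1) := by
          rw [mul_sum]
          exact sum_congr rfl fun j _ => by ring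
      _ ≤ (c₁ + c₂) * g₀ ^ 2 * (θ / (1 - θ) ^ 2) := by
          gcongr
          exact sum_range_cast_succ_mul_pow_le hθ0.le hθ1 n
      _ = (c₁ + c₂) * (θ / (1 - θ) ^ 2) * g₀ ^ 2 := by ring
  have key := abs_le_of_iterate_bounded hθ0.le hθ1 haθ hdrec hdM hS
  have hd0 : d 0 = μ 0 + 2 * G * g₀ := by
    simp only [hd, hm, hT0, pow_zero]
    ring
  have hconst : (c₁ + c₂) * (θ / (1 - θ) ^ 2) = muFlowConst L A B := by
    rw [muFlowConst, hc₁, hc₂, hκ, hA', hD, hθ, hΛ]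
  rwa [hd0, hconst] at key

/-! ### The inputs of §8.5 as a hypothesis structure (Proposition 7.1's flow at `m² = 0`) -/

/-- **The renormalisation-group inputs of §8.5 at `m² = 0`** (Bauerschmidt–Brydges–Slade 2015),
as hypotheses on a function `φ` (in the source `φ = μ₀ᶜ(0,·) = ν₀ᶜ(0,·)`), a number `G` (in the
source `C(0) = C₀(0)`), `δ' > 0` (the `δ` of Proposition 7.1), `L` (the scale, `L > 1`; in print a
large integer), constants `A, B` for the printed `O(·)`'s, `C₁ j = C_{j+1;0,0}` (the diagonal of the
finite-range decomposition `C = (−Δ)⁻¹ = Σ_{j≥1} C_j` at `m² = 0`) and `β j = β_j` (the coefficient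
of [BBS-rg-pt], §6.1, at `m² = 0`). Transcribed: "`C(0) = Σ_{l≥0} C_{l+1;0,0}`" and
"`C_{l+1;0,0} = O(L^{-2l})`" (§8.5); "the sequence `(β_j)` is bounded" (Assumption (A1), §6.1); and,
for every `g₀ ∈ (0,δ')`, the transformed flow `V̌_j = T_j(V_j) = (ǧ_j, ž_j, μ̌_j)` of the global
flow of Proposition 7.1 with `V₀ = (g₀, z₀ᶜ(0,g₀), μ₀ᶜ(0,g₀))` and `T₀(V) = V` (§6.1), read as real
sequences `μ = μ̌`, `gc = ǧ`: `μ̌₀ = μ₀ᶜ(0,g₀) = φ(g₀)` ("`μ₀ᶜ = μ̌₀`", §8.5), `ǧ₀ = g₀`; "by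
Proposition 7.1, the sequence `μ̌_j` is bounded"; `ǧ_j = O(ḡ_j)` (Proposition 7.1) with
`χ_jḡ_j = O(ḡ₀/(1+ḡ₀j))`, `ḡ₀ = g₀` (Proposition 6.1, §7.2), read `|ǧ_j| ≤ Ag₀`; the recursion
"`μ̌_{j+1} = L²μ̌_j(1 - γβ_jǧ_j) + η_jǧ_j + O(χ_jḡ_j²)`", `γ = ¼`, with
"`η_j = 2L^{2(j+1)}C_{j+1;0,0}`" ([BBS-rg-pt], recalled in §8.5) and the error read `|e_j| ≤ Ag₀²`
(`χ_j = 1` at `m² = 0`, `ḡ_j = O(g₀)`); and "`ǧ_{j+1} = ǧ_j - β_jǧ_j² + r_j` with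
`r_j = O(χ_jǧ_j³)`" (§8.3). All `O(·)` constants uniform (§7–8); the bound `M` on `μ̌` may depend
on `g₀` (weaker). A HYPOTHESIS structure, like `Thm41Data`: nothing is asserted. NB: at this
level of abstraction (free error terms of the printed orders) the structure is EQUIVALENT in
strength to the §8.5 conclusion it yields (`MuFlowAt.asymptotics`, `MuFlowAt.of_bound`), which
is why no named fact "Theorem 4.1 ∧ flow" is vendored — it would restate `BBS2015_thm41_nu0c`;
what the structure buys is that the §8.5 derivation is checked for ANY data with the printed
flow properties, in particular for Proposition 7.1's.
[cite: BauerschmidtBrydgesSlade2015LogCorr, Proposition 7.1, Proposition 6.1, §6.1 (A1), §8.3 and §8.5] -/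
structure MuFlowAt (φ : ℝ → ℝ) (G δ' L A B : ℝ) (C₁ β : ℕ → ℝ) : Prop where
  /-- `δ' > 0`. -/
  pos : 0 < δ'
  /-- The scale `L > 1`. -/
  one_lt : 1 < L
  /-- `C(0) = Σ_{l≥0} C_{l+1;0,0}` (§8.5). -/
  hasSum_C₁ : HasSum C₁ G
  /-- `C_{l+1;0,0} = O(L^{-2l})` (§8.5). -/
  abs_C₁_mul_le : ∀ j, |C₁ j| * L ^ (2 * j) ≤ A
  /-- `(β_j)` is bounded (Assumption (A1)). -/
  abs_β_le : ∀ j, |β j| ≤ B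
  /-- Proposition 7.1's flow at `m² = 0` for `g₀ ∈ (0,δ')`: `μ = μ̌`, `gc = ǧ`, the errors `e, r`,
  a bound `M`. -/
  flow : ∀ g₀ ∈ Ioo (0 : ℝ) δ', ∃ (μ gc e r : ℕ → ℝ) (M : ℝ),
    μ 0 = φ g₀ ∧ gc 0 = g₀ ∧ (∀ j, |μ j| ≤ M) ∧ (∀ j, |gc j| ≤ A * g₀) ∧
    (∀ j, μ (j + 1) =
      L ^ 2 * μ j * (1 - (1 / 4 : ℝ) * β j * gc j) + 2 * L ^ (2 * (j + 1)) * C₁ j * gc j + e j) ∧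
    (∀ j, |e j| ≤ A * g₀ ^ 2) ∧
    (∀ j, gc (j + 1) = gc j - β j * gc j ^ 2 + r j) ∧ (∀ j, |r j| ≤ A * |gc j| ^ 3)

namespace MuFlowAt

variable {φ : ℝ → ℝ} {G δ' L A B : ℝ} {C₁ β : ℕ → ℝ}

/-- The `O(·)` constant `A` is nonnegative. [cite: BauerschmidtBrydgesSlade2015LogCorr, §8.5] -/
theorem A_nonneg (h : MuFlowAt φ G δ' L A B C₁ β) : 0 ≤ A := by
  have h0 := h.abs_C₁_mul_le 0
  simp only [mul_zero, pow_zero, mul_one] at h0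
  exact (abs_nonneg _).trans h0

/-- The bound `B` on `β_j` is nonnegative. [cite: BauerschmidtBrydgesSlade2015LogCorr, §6.1 (A1)] -/
theorem B_nonneg (h : MuFlowAt φ G δ' L A B C₁ β) : 0 ≤ B :=
  (abs_nonneg _).trans (h.abs_β_le 0)

/-- §8.5 for the flow data, pointwise with the explicit constant: for `0 < g₀ < δ'`,
`g₀ ≤ muFlowThreshold L A B`, `|φ(g₀) + 2Gg₀| ≤ muFlowConst L A B · g₀²`.
[cite: BauerschmidtBrydgesSlade2015LogCorr, §8.5 (proof of Theorem 1.2)] -/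
theorem abs_add_le (h : MuFlowAt φ G δ' L A B C₁ β) {g₀ : ℝ} (hg₀ : 0 < g₀) (hg₀δ : g₀ < δ')
    (hg₀t : g₀ ≤ muFlowThreshold L A B) : |φ g₀ + 2 * G * g₀| ≤ muFlowConst L A B * g₀ ^ 2 := by
  obtain ⟨μ, gc, e, r, M, hμ0, hgc0, hμM, hgcA, hrec, he, hgrec, hr⟩ := h.flow g₀ ⟨hg₀, hg₀δ⟩
  rw [← hμ0]
  exact abs_mu_zero_add_le h.one_lt h.hasSum_C₁ h.abs_C₁_mul_le h.abs_β_le hg₀ hg₀t hgc0 hμM hgcA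
    hrec he hgrec hr

/-- **§8.5 of Bauerschmidt–Brydges–Slade 2015, proved** from the flow inputs:
`φ(g₀) = -2Gg₀ + O(g₀²)` as `g₀ ↓ 0`, i.e. (with `φ = μ₀ᶜ(0,·)`, `G = C(0)`)
"`μ₀ᶜ(0,g₀) = -2C(0)g₀ + O(g₀²)`". [cite: BauerschmidtBrydgesSlade2015LogCorr, §8.5 (proof of Theorem 1.2)] -/
theorem asymptotics (h : MuFlowAt φ G δ' L A B C₁ β) :
    ∃ C δ₂ : ℝ, 0 < δ₂ ∧ ∀ g₀ ∈ Ioo (0 : ℝ) δ₂, |φ g₀ + 2 * G * g₀| ≤ C * g₀ ^ 2 :=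
  ⟨muFlowConst L A B, min δ' (muFlowThreshold L A B),
    lt_min h.pos (muFlowThreshold_pos h.one_lt h.A_nonneg h.B_nonneg), fun _ hg₀ =>
      h.abs_add_le hg₀.1 (hg₀.2.trans_le (min_le_left _ _)) (hg₀.2.le.trans (min_le_right _ _))⟩

/-- Conversely, the §8.5 conclusion alone already furnishes data satisfying `MuFlowAt` (with
`L = 2`, `β = 0`, `C₁ = (G, 0, 0, …)`, `ǧ_j = g₀`, `μ̌ = (φ(g₀), 0, 0, …)` and the error
`e₀ = -4(φ(g₀) + 2Gg₀) = O(g₀²)`): at this level of abstraction the flow hypotheses carry no more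
than the asymptotics, so no named fact is built on them. [folklore] -/
theorem of_bound {C δ₂ : ℝ} (hδ₂ : 0 < δ₂)
    (hb : ∀ g₀ ∈ Ioo (0 : ℝ) δ₂, |φ g₀ + 2 * G * g₀| ≤ C * g₀ ^ 2) :
    MuFlowAt φ G δ₂ 2 (max (4 * |C|) (max 1 |G|)) 0 (fun j => if j = 0 then G else 0)
      (fun _ => 0) where
  pos := hδ₂
  one_lt := one_lt_two
  hasSum_C₁ := hasSum_ite_eq 0 G
  abs_C₁_mul_le j := by
    by_cases hj : j = 0
    · subst hj
      simp only [if_true, mul_zero, pow_zero, mul_one]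
      exact le_max_of_le_right (le_max_right _ _)
    · simp only [if_neg hj, abs_zero, zero_mul]
      positivity
  abs_β_le _ := by simp
  flow g₀ hg₀ := by
    have hA1 : (1 : ℝ) ≤ max (4 * |C|) (max 1 |G|) := le_max_of_le_right (le_max_left _ _)
    have hAC : 4 * |C| ≤ max (4 * |C|) (max 1 |G|) := le_max_left _ _
    have hA0 : (0 : ℝ) ≤ max (4 * |C|) (max 1 |G|) := zero_le_one.trans hA1
    refine ⟨fun j => if j = 0 then φ g₀ else 0, fun _ => g₀,
      fun j => if j = 0 then -(4 * (φ g₀ + 2 * G * g₀)) else 0, fun _ => 0, |φ g₀|, by simp, rfl,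
      fun j => ?_, fun j => ?_, fun j => ?_, fun j => ?_, fun j => ?_, fun j => ?_⟩
    · by_cases hj : j = 0 <;> simp [hj]
    · rw [abs_of_pos hg₀.1]
      nlinarith [hg₀.1]
    · by_cases hj : j = 0
      · subst hj
        simp only [zero_add, one_ne_zero, if_false, if_true]
        ring
      · simp [hj]
    · by_cases hj : j = 0
      · subst hj
        simp only [if_true, abs_neg, abs_mul]
        rw [abs_of_pos (by norm_num : (0 : ℝ) < 4)]
        calc 4 * |φ g₀ + 2 * G * g₀| ≤ 4 * (C * g₀ ^ 2) := by gcongr; exact hb g₀ hg₀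
          _ ≤ 4 * (|C| * g₀ ^ 2) := by gcongr; exact le_abs_self C
          _ = 4 * |C| * g₀ ^ 2 := by ring
          _ ≤ max (4 * |C|) (max 1 |G|) * g₀ ^ 2 := by gcongr
      · simp only [if_neg hj, abs_zero]
        positivity
    · simp
    · simp only [abs_zero]
      positivity

end MuFlowAt

/-! ### The reduction of `BBS2015_thm41_nu0c` to Theorem 4.1's data with the §8.5 flow inputs -/

/-- **`BBS2015_thm41_nu0c` from Theorem 4.1 and Proposition 7.1's flow**: if `(δ, K, ν₀ᶜ, z₀ᶜ, c)`
satisfy the conclusions of Theorem 4.1 (`Thm41Data`) and `ν₀ᶜ(0,·)` is the initial condition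
`μ̌₀` of a flow with the §8.5 inputs at `m² = 0` and `G = C₀(0) = greenZero 4` (`MuFlowAt`), then
the bundled named fact `BBS2015_thm41_nu0c` holds — its §8.5 clause being now a theorem
(`MuFlowAt.asymptotics`). In print both hypotheses are established for `(ν₀ᶜ, z₀ᶜ) = (μ₀ᶜ, z₀ᶜ)`
of Proposition 7.1 (§8.4, §8.5); they are the renormalisation-group input and are not proved
in the tree. [cite: BauerschmidtBrydgesSlade2015LogCorr, Theorem 4.1, Proposition 7.1 and §8.5] -/
theorem BBS2015_thm41_nu0c_of_muFlowAt {δ K : ℝ} {ν₀c z₀c : ℝ → ℝ → ℝ} {c : ℝ → ℝ}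
    {δ' L A B : ℝ} {C₁ β : ℕ → ℝ} (hD : Thm41Data δ K ν₀c z₀c c)
    (hF : MuFlowAt (ν₀c 0) (greenZero 4) δ' L A B C₁ β) : BBS2015_thm41_nu0c :=
  ⟨δ, K, ν₀c, z₀c, c, hD, hF.asymptotics⟩

/-- Theorem 1.2 from Theorem 4.1's data, Proposition 7.1's flow and Proposition 4.2(ii).
[cite: BauerschmidtBrydgesSlade2015LogCorr, §8.5 (proof of Theorem 1.2)] -/
theorem BBS2015_thm12_of_muFlowAt {δ K : ℝ} {ν₀c z₀c : ℝ → ℝ → ℝ} {c : ℝ → ℝ}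
    {δ' L A B : ℝ} {C₁ β : ℕ → ℝ} (hD : Thm41Data δ K ν₀c z₀c c)
    (hF : MuFlowAt (ν₀c 0) (greenZero 4) δ' L A B C₁ β) (h42 : BBS2015_prop42ii) :
    BBS2015_thm12 :=
  BBS2015_thm12_of_thm41_nu0c (BBS2015_thm41_nu0c_of_muFlowAt hD hF) h42

/-- Theorem 1.2 from Theorem 4.1's data, Proposition 7.1's flow and **Lemma A.1** (Proposition
4.2(ii) being proved from Theorem 4.1 and Lemma A.1 in `…ChangeOfParameters.lean`): the whole
printed "Proof of Theorem 1.2" (§8.5) is thereby checked down to Theorem 4.1 and the flow inputs.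
[cite: BauerschmidtBrydgesSlade2015LogCorr, §8.5 (proof of Theorem 1.2), Proposition 4.2, Lemma A.1] -/
theorem BBS2015_thm12_of_muFlowAt_of_lemA1 {δ K : ℝ} {ν₀c z₀c : ℝ → ℝ → ℝ} {c : ℝ → ℝ}
    {δ' L A B : ℝ} {C₁ β : ℕ → ℝ} (hD : Thm41Data δ K ν₀c z₀c c)
    (hF : MuFlowAt (ν₀c 0) (greenZero 4) δ' L A B C₁ β) (hA : BBS2015_lemA1) : BBS2015_thm12 :=
  BBS2015_thm12_of_thm41_nu0c_of_lemA1 (BBS2015_thm41_nu0c_of_muFlowAt hD hF) hA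

end CTWSAW

end Literature.Barriers.CriticalPhenomena
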